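import Literature.Probability.Process.ConformalDDS
import Literature.Probability.Process.BrownianVecIncrementCharFun
import HarnessLib

/-!
# The enlargement: the time-changed process continued by an independent Brownian motion

Sixth file on P. Lévy's conformal invariance of planar Brownian motion (Lawler (2005), Thm. 2.2;
Le Gall (2016), Thm. 5.13 (Dambis–Dubins–Schwarz) and Thm. 7.19). On the product of the space of
`W` with the space of an independent planar Brownian motion `W'` we consider the enlarged
time-changed process `β̃_u(ω, ω') = Ỹ_u(ω) + W'_{(u − S(ω))⁺}(ω')` (`tcEnl`, `ConformalTimeChangeDefs`)
and compute the joint characteristic function of its increments over ordered levels: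

* `integral_cexp_sum_tcEnl_incr` — **`E[exp(i Σ_{j<n} Re(θ̄ⱼ(β̃_{u_{j+1}} − β̃_{u_j})))] =
  Π_{j<n} exp(−(u_{j+1} − u_j)|θⱼ|²/2)`**, the joint characteristic function of the increments of
  a planar Brownian motion.

Proof: Fubini; for fixed `ω` the `W'`-increments over the deterministic times
`r_j = (u_j − S)⁺` contribute `Π exp(−(r_{j+1} − r_j)|θⱼ|²/2)` (`BrownianVecIncrementCharFun`);
since `r_{j+1} − r_j = (u_{j+1} − u_j) − (σ̃_{u_{j+1}} − σ̃_{u_j})` (`σ̃_u = u ∧ S`), the remaining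
`ω`-integral is `Π exp(−Δu_j|θⱼ|²/2) · E[Π_j E^{θⱼ}_{α_{u_{j+1}}}/E^{θⱼ}_{α_{u_j}}]`, and the last
expectation is `1` (`ConformalDDS`).

## References

* J.-F. Le Gall, *Brownian Motion, Martingales, and Stochastic Calculus* (2016), Thm. 5.13
  (proof: enlargement of the probability space), Cor. 2.4.
* G. F. Lawler, *Conformally Invariant Processes in the Plane*, AMS (2005), Thm. 2.2.
-/

noncomputable section

open MeasureTheory ProbabilityTheory Filter Topology Set Complex
open scoped NNReal ENNReal BigOperators ComplexConjugate

namespace Literature.Probability.Process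

/-! ### Small identities -/

/-- `Re(θ̄ · toC v) = Re θ · v₀ + Im θ · v₁`. [folklore] -/
theorem re_conj_mul_toC (θ : ℂ) (v : Fin 2 → ℝ) :
    (conj θ * toC v).re = ∑ i, ![θ.re, θ.im] i * v i := by
  rw [Fin.sum_univ_two]
  simp [Complex.mul_re]

/-- `|θ|² = (Re θ)² + (Im θ)²` as a sum over the two coordinates. [folklore] -/
theorem sum_sq_reIm (θ : ℂ) : ∑ i, (![θ.re, θ.im] i) ^ 2 = ‖θ‖ ^ 2 := by
  rw [Fin.sum_univ_two, Complex.sq_norm, Complex.normSq_apply]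
  simp; ring

/-- `toC` is additive (subtraction). [folklore] -/
theorem toC_sub (v w : Fin 2 → ℝ) : toC (v - w) = toC v - toC w := by
  apply Complex.ext <;> simp

/-- `(a − S)⁺ = a − a ∧ S`. [folklore] -/
theorem coe_toNNReal_sub_eq (a S : ℝ) : ((a - S).toNNReal : ℝ) = a - min a S := by
  rw [Real.coe_toNNReal']
  rcases le_total a S with h | h
  · rw [min_eq_left h, max_eq_right (by linarith), sub_self]
  · rw [min_eq_right h, max_eq_left (by linarith)]

/-- `a ↦ (a − S)⁺` is monotone. [folklore] -/
theorem toNNReal_sub_mono (S : ℝ) : Monotone fun a : ℝ ↦ (a - S).toNNReal :=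
  fun _ _ h ↦ Real.toNNReal_le_toNNReal (by linarith)

variable {Ω Ω' : Type*} {mΩ : MeasurableSpace Ω} {mΩ' : MeasurableSpace Ω'} {P : Measure Ω}
  {P' : Measure Ω'} {W : ℝ≥0 → Ω → (Fin 2 → ℝ)} {W' : ℝ≥0 → Ω' → (Fin 2 → ℝ)}

namespace IsBrownianVec

variable {x₀ : Fin 2 → ℝ} {U : Set (Fin 2 → ℝ)} {D : Set ℂ} {f : ℂ → ℂ}

/-! ### Measurability of the time-changed and enlarged processes -/

/-- The total clock is measurable (it is the clock sampled at the exit time). [folklore] -/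
theorem measurable_totClock (hW : IsBrownianVec W P) (hD : IsOpen D) (hf : DifferentiableOn ℂ f D)
    (hU : IsOpen U) (hUD : closure U ⊆ toC ⁻¹' D) (hx₀ : x₀ ∈ U) : Measurable (totClock x₀ W f U) := by
  have hprog : IsStronglyProgressive hW.natFiltration (confClock x₀ W f U) :=
    (hW.stronglyAdapted_confClock hD hf hU hUD hx₀).isStronglyProgressive_of_continuous
      fun ω ↦ hW.continuous_confClock hD hf hU hUD hx₀ ω
  have hρ := hW.isStoppingTime_hitTime (x₀ := x₀) hU.isClosed_compl
  exact (measurable_stoppedValue hprog hρ).mono hρ.measurableSpace_le le_rfl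

/-- The time-changed process is measurable (`f` is only read on `closure U`, where it is
continuous). [folklore] -/
theorem measurable_tcPos (hW : IsBrownianVec W P) (hD : IsOpen D) (hf : DifferentiableOn ℂ f D)
    (hU : IsOpen U) (hUD : closure U ⊆ toC ⁻¹' D) (hx₀ : x₀ ∈ U) (u : ℝ≥0) :
    Measurable (tcPos x₀ W f U u) := by
  have hsv := (hW.measurable_stoppedValue_confPos hD hf hU hUD hx₀ u).mono
    (hW.isStoppingTime_clockInv hD hf hU hUD hx₀ u).measurableSpace_le le_rfl
  have hmem : ∀ ω, stoppedValue (confPos x₀ W U) (clockInv x₀ W f U u) ω ∈ closure U := fun ω ↦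
    hW.confPos_mem_closure hU hx₀ _ ω
  have hc : Continuous ((closure U).restrict fun v ↦ f (toC v)) :=
    ((hf.continuousOn.comp continuous_toC.continuousOn fun v hv ↦ hv).mono hUD).restrict
  have hm : Measurable fun ω ↦ (⟨stoppedValue (confPos x₀ W U) (clockInv x₀ W f U u) ω, hmem ω⟩ : closure U) :=
    hsv.subtype_mk
  exact hc.measurable.comp hm

/-- The second Brownian motion read at an `ω`-dependent time is jointly measurable. [folklore] -/
theorem measurable_comp_randomTime (hW' : IsBrownianVec W' P') {g : Ω → ℝ≥0} (hg : Measurable g) :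
    Measurable fun p : Ω × Ω' ↦ W' (g p.1) p.2 := by
  have hunc : Measurable (Function.uncurry W') :=
    measurable_uncurry_of_continuous_of_measurable hW'.continuous_path hW'.measurable
  exact hunc.comp ((hg.comp measurable_fst).prodMk measurable_snd)

/-- The enlarged time-changed process is measurable on the product space. [folklore] -/
theorem measurable_tcEnl (hW : IsBrownianVec W P) (hW' : IsBrownianVec W' P') (hD : IsOpen D)
    (hf : DifferentiableOn ℂ f D) (hU : IsOpen U) (hUD : closure U ⊆ toC ⁻¹' D) (hx₀ : x₀ ∈ U) (u : ℝ≥0) :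
    Measurable (tcEnl x₀ W f U W' u) := by
  unfold tcEnl
  refine ((hW.measurable_tcPos hD hf hU hUD hx₀ u).comp measurable_fst).add (measurable_toC.comp ?_)
  exact hW'.measurable_comp_randomTime
    ((measurable_const.sub (hW.measurable_totClock hD hf hU hUD hx₀)).real_toNNReal)

/-! ### The joint characteristic function of the increments -/

section Main

variable [IsProbabilityMeasure P] [IsProbabilityMeasure P']

/-- **The increments of the enlarged time-changed process have the joint characteristic function
of the increments of a planar Brownian motion**: for ordered levels `u₀ ≤ u₁ ≤ ⋯` and
`θⱼ ∈ ℂ`,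
`E[exp(i Σ_{j<n} Re(θ̄ⱼ(β̃_{u_{j+1}} − β̃_{u_j})))] = Π_{j<n} exp(−(u_{j+1} − u_j)|θⱼ|²/2)`.
[cite: Legall2016, Thm. 5.13 (proof)] -/
theorem integral_cexp_sum_tcEnl_incr (hW : IsBrownianVec W P) (hW' : IsBrownianVec W' P')
    (hD : IsOpen D) (hf : DifferentiableOn ℂ f D) (hU : IsOpen U) (hUb : Bornology.IsBounded U)
    (hUD : closure U ⊆ toC ⁻¹' D) (hx₀ : x₀ ∈ U) {u : ℕ → ℝ≥0} (hu : Monotone u) (θ : ℕ → ℂ) (n : ℕ) :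
    ∫ p, cexp (I * (∑ j ∈ Finset.range n,
        (conj (θ j) * (tcEnl x₀ W f U W' (u (j + 1)) p - tcEnl x₀ W f U W' (u j) p)).re : ℝ)) ∂(P.prod P') =
      ∏ j ∈ Finset.range n, cexp (-(((u (j + 1) : ℝ) - u j) * ‖θ j‖ ^ 2 / 2 : ℝ)) := by
  -- the `ω`-dependent times of the second Brownian motion
  set r : ℕ → Ω → ℝ≥0 := fun k ω ↦ ((u k : ℝ) - totClock x₀ W f U ω).toNNReal with hr
  have hrm : ∀ k, Measurable (r k) := fun k ↦
    (measurable_const.sub (hW.measurable_totClock hD hf hU hUD hx₀)).real_toNNReal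
  have hrmono : ∀ ω, Monotone fun k ↦ r k ω := fun ω a b hab ↦
    toNNReal_sub_mono _ (NNReal.coe_le_coe.2 (hu hab))
  -- the two factors
  set A : Ω → ℂ := fun ω ↦ cexp (I * (∑ j ∈ Finset.range n,
    (conj (θ j) * (tcPos x₀ W f U (u (j + 1)) ω - tcPos x₀ W f U (u j) ω)).re : ℝ)) with hA
  set B : Ω → Ω' → ℂ := fun ω ω' ↦ cexp (I * (∑ j ∈ Finset.range n,
    ∑ i, ![(θ j).re, (θ j).im] i * (W' (r (j + 1) ω) ω' - W' (r j ω) ω') i : ℝ)) with hB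
  -- pointwise factorisation of the integrand
  have hfac : ∀ p : Ω × Ω', cexp (I * (∑ j ∈ Finset.range n,
      (conj (θ j) * (tcEnl x₀ W f U W' (u (j + 1)) p - tcEnl x₀ W f U W' (u j) p)).re : ℝ)) = A p.1 * B p.1 p.2 := by
    intro p
    rw [hA, hB, ← Complex.exp_add]
    congr 1
    rw [← mul_add, ← Complex.ofReal_add, ← Finset.sum_add_distrib]
    congr 2
    refine Finset.sum_congr rfl fun j _ ↦ ?_
    have e : tcEnl x₀ W f U W' (u (j + 1)) p - tcEnl x₀ W f U W' (u j) p =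
        (tcPos x₀ W f U (u (j + 1)) p.1 - tcPos x₀ W f U (u j) p.1) +
          toC (W' (r (j + 1) p.1) p.2 - W' (r j p.1) p.2) := by
      simp only [tcEnl, hr, toC_sub]; ring
    rw [e, mul_add, Complex.add_re, re_conj_mul_toC]
  -- measurability and boundedness
  have hAm : Measurable A := by
    refine Complex.measurable_exp.comp (measurable_const.mul (Complex.measurable_ofReal.comp ?_))
    refine Finset.measurable_sum _ fun j _ ↦ Complex.measurable_re.comp (measurable_const.mul ?_)
    exact (hW.measurable_tcPos hD hf hU hUD hx₀ _).sub (hW.measurable_tcPos hD hf hU hUD hx₀ _)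
  have hBm : Measurable (Function.uncurry B) := by
    refine Complex.measurable_exp.comp (measurable_const.mul (Complex.measurable_ofReal.comp ?_))
    refine Finset.measurable_sum _ fun j _ ↦ Finset.measurable_sum _ fun i _ ↦ Measurable.const_mul ?_ _
    exact (measurable_pi_apply i).comp ((hW'.measurable_comp_randomTime (hrm (j + 1))).sub
      (hW'.measurable_comp_randomTime (hrm j)))
  have hA1 : ∀ ω, ‖A ω‖ = 1 := fun ω ↦ by rw [hA]; simp only; rw [mul_comm, Complex.norm_exp_ofReal_mul_I]
  have hB1 : ∀ ω ω', ‖B ω ω'‖ = 1 := fun ω ω' ↦ by rw [hB]; simp only; rw [mul_comm, Complex.norm_exp_ofReal_mul_I]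
  have hint : Integrable (fun p : Ω × Ω' ↦ A p.1 * B p.1 p.2) (P.prod P') := by
    refine ⟨((hAm.comp measurable_fst).mul hBm).aestronglyMeasurable, HasFiniteIntegral.of_bounded (C := 1) ?_⟩
    exact ae_of_all _ fun p ↦ by rw [norm_mul, hA1, hB1, mul_one]
  -- Fubini
  simp_rw [hfac]
  rw [integral_prod _ hint]
  simp only
  -- the inner integral: characteristic function of the `W'`-increments
  have hinner : ∀ ω, ∫ ω', A ω * B ω ω' ∂P' =
      A ω * ∏ j ∈ Finset.range n, cexp (-(((r (j + 1) ω : ℝ) - r j ω) * ‖θ j‖ ^ 2 / 2 : ℝ)) := by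
    intro ω
    rw [integral_const_mul, hB]
    simp only
    rw [hW'.integral_cexp_sum_incr (hrmono ω) (fun j ↦ ![(θ j).re, (θ j).im]) n]
    simp_rw [sum_sq_reIm]
  simp_rw [hinner]
  -- rewrite `r_{j+1} − r_j = Δu_j − Δσ̃_j` almost surely and recognise the DDS product
  have hae : ∀ᵐ ω ∂P, A ω * ∏ j ∈ Finset.range n, cexp (-(((r (j + 1) ω : ℝ) - r j ω) * ‖θ j‖ ^ 2 / 2 : ℝ)) =
      (∏ j ∈ Finset.range n, cexp (-(((u (j + 1) : ℝ) - u j) * ‖θ j‖ ^ 2 / 2 : ℝ))) *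
        ∏ j ∈ Finset.range n,
          stoppedValue (confExp (θ j) x₀ W f U) (clockInv x₀ W f U (u (j + 1))) ω /
            stoppedValue (confExp (θ j) x₀ W f U) (clockInv x₀ W f U (u j)) ω := by
    filter_upwards [hW.ae_stoppedValue_confClock_eq hD hf hU hUb hUD hx₀] with ω hω
    have hrr : ∀ k, (r k ω : ℝ) = u k - min (u k : ℝ) (totClock x₀ W f U ω) := fun k ↦ coe_toNNReal_sub_eq _ _
    simp_rw [stoppedValue_confExp_div, hω]
    -- `A ω` as a product over `j`
    have e1 : A ω = ∏ j ∈ Finset.range n, cexp (I * ((conj (θ j) *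
        (tcPos x₀ W f U (u (j + 1)) ω - tcPos x₀ W f U (u j) ω)).re : ℝ)) := by
      rw [hA]
      simp only
      rw [← Complex.exp_sum]
      congr 1
      push_cast
      rw [Finset.mul_sum]
    rw [e1, ← Finset.prod_mul_distrib, ← Finset.prod_mul_distrib]
    refine Finset.prod_congr rfl fun j _ ↦ ?_
    rw [← Complex.exp_add, ← Complex.exp_add]
    congr 1
    rw [hrr, hrr]
    push_cast
    ring
  rw [integral_congr_ae hae, integral_const_mul,
    (hW.integral_prod_confExp_ratio_eq_one hD hf hU hUb hUD hx₀ hu θ n).2, mul_one]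

end Main

end IsBrownianVec

end Literature.Probability.Process

end
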